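import Literature.NumberTheory.Automorphic.Liu2021.LemD1AsPrintedIndexedNonVacuityRamifiedConverse
import Literature.NumberTheory.Automorphic.Liu2021.FinAdelicCheckSurjective
import Literature.NumberTheory.Automorphic.UnitaryGroupSplitPlace
import HarnessLib

/-!
# An ANTI-FIXED uniformiser at a tamely ramified non-split place: `σ_w ϖ_w = −ϖ_w`, `v_w(ϖ_w) = exp(−1)`
(Serre, *Local Fields*, Ch. III §6 and Ch. IV §1–§2: a tamely ramified quadratic extension of local fields is `F_v(√π)`; Jacobowitz (1962)
§5, §8: hermitian lattices over a ramified quadratic order, where every computation starts from a uniformiser `ϖ` with `σ ϖ = −ϖ`)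

Topic `NumberTheory/Automorphic`; namespace `Literature.NumberTheory.Automorphic.UnitaryGroup`.  KERNEL mathematics only: theorems, no
definition, no named fact, no instance, no notation, no `sorry`.  Cell `pub/hodgecm-mathlib`, crux H413 = `stmt-HodgeConjecture-24833`, line
«N6nsGerm»; the RAMIFIED halves of `stub_N6nsR2EP : RankOneEulerPoincareNonsplit` (census `F0/P3a/A-p06/g27/CENSUS-R2ram-….md` §5 (r0)) and of
`stub_N6nsR1LL : RankOneUnstableTransferNonsplitCME` (road R1-ram) both run on the abstract DVR-with-involution frame of ★
`LocalFields/RamifiedQuadraticOrderUnitIndex` ∕ `…Lattices` ∕ `RamifiedQuadraticLatticeDoubleCosets`, whose binders are `hσ` (involution), `hres`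
(residually trivial), `h2 : IsUnit 2`, `hϖ : Irreducible ϖ`, **`hσϖ : σ ϖ = −ϖ`**.  At a CONCRETE place `w ∣ v` the tree supplies `hres` (★
`valued_galAdicCompletionMap_sub_lt_one_of_ramified`), `e(w|v) = 2` (★ `ramificationIdx'_eq_two_of_ne_one`) and `σ_w`-FIXED uniformisers at
UNRAMIFIED places (★ `valued_toPlace_uniformizer_of_isUnramifiedIn`); THIS FILE supplies the anti-fixed uniformiser at a ramified one (seat
F0P3a-p04 (g13); LEAD F0P3a-plan (g10) WORD T9-13 (3)).  HONEST LABEL: HC_CM is proved only modulo the printed citations until rung 0 closes;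
nothing printed is asserted here.

THE MATHEMATICS (`E ∕ F` quadratic, `c ∈ Aut(E∕F)`, `c ≠ 1`, `w ∣ v` with `c • w = w`, `σ_w := galAdicCompletionMap c hw : E_w →+* E_w`, `e(w|v) ≠ 1`,
`2 ∈ 𝒪_w^×`).  (1) NO ANTI-FIXED UNIT: if `v_w(y) ≤ 1` and `σ_w y = −y` then `v_w(y) < 1` — residual triviality gives `v_w(σ_w y − y) = v_w(2y) < 1`.
(2) ANTI-FIXED ELEMENTS HAVE ODD VALUATION: `P := ι_w(π_v)` (`π_v` a uniformiser of `F_v`) is `σ_w`-fixed with `v_w(P) = exp(−1)^{e} = exp(−2)`;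
if `σ_w y = −y`, `y ≠ 0`, `v_w(y) = exp(2k)`, then `y · P^{k}` is an anti-fixed unit, contradicting (1).  (3) EXISTENCE: `σ_w ≠ id` (★
`exists_galAdicCompletionMap_ne`), so `D := x − σ_w x ≠ 0` for some `x`, and `σ_w D = −D` (`σ_w² = id`, ★ `algEquiv_mul_self_eq_one`); by (2)
`v_w(D) = exp(2k+1)` and **`ϖ := D · P^{k+1}`** has `v_w(ϖ) = exp(−1)`, `σ_w ϖ = −ϖ`.  (4) The CM row.  NOT here: `Irreducible` ∕ `IsUniformizer`
re-spellings inside `𝒪_w` (consumers holding `Valued.v ϖ = exp(−1)` get them from Mathlib's `Valuation.Integers` API), wild ramification (`v ∣ 2`: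
then (1) fails — `ℚ₂(i) ∕ ℚ₂` has the anti-fixed UNIT `i` and NO anti-fixed uniformiser).

## References
* [SerreLocalFields1979] J.-P. Serre, *Local Fields*, GTM 67 (1979), Ch. III §6, Ch. IV §§1–2 (tame ramification, `e = 2`, `f = 1`).
* [Jacobowitz1962] R. Jacobowitz, *Hermitian forms over local fields*, Amer. J. Math. 84 (1962), §5 and §8 (ramified case, `π` with `π̄ = −π`).
* [NeukirchANT1999] J. Neukirch, *Algebraic Number Theory* (1999), Ch. II §5 Prop. (5.3), Ch. II §7 (tamely ramified extensions).
-/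

set_option autoImplicit false

noncomputable section

open NumberField IsDedekindDomain
open scoped Valued

namespace Literature.NumberTheory.Automorphic.UnitaryGroup

open Literature.NumberTheory.Automorphic.Liu2021
open Literature.NumberTheory.Automorphic.Liu2021.LemD1IndexedNonVacuityRamifiedConverse (valued_galAdicCompletionMap_sub_lt_one_of_ramified)
open Literature.NumberTheory.Automorphic.Liu2021.LemD1IndexedNonVacuityRamifiedPlace (ramificationIdx'_eq_two_of_ne_one)
open Literature.NumberTheory.GaloisRepresentations (HeckeCharacter)

variable {F : Type} (E : Type) [Field F] [NumberField F] [Field E] [NumberField E] [Algebra F E]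
  [Algebra.IsQuadraticExtension F E] (c : E ≃ₐ[F] E) {v : HeightOneSpectrum (𝓞 F)}

/-! ## §1 No anti-fixed unit at a tamely ramified place -/

/-- **NO ANTI-FIXED UNIT at a tamely ramified non-split place**: if `v_w(y) ≤ 1` and `σ_w y = −y` then `v_w(y) < 1`.  Residual triviality of
`σ_w` (★ `valued_galAdicCompletionMap_sub_lt_one_of_ramified`) gives `v_w(σ_w y − y) = v_w(−2y) = v_w(y) < 1` as `v_w(2) = 1`.
[cite: Jacobowitz1962, §5] [cite: SerreLocalFields1979, Ch. IV §2 Prop. 5] -/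
theorem valued_lt_one_of_galAdicCompletionMap_eq_neg (hc : c ≠ 1) (w : PlacesOver E v) (hw : c • w.1 = w.1)
    (he : v.asIdeal.ramificationIdx' w.1.asIdeal ≠ 1) (h2 : Valued.v (2 : w.1.adicCompletion E) = 1)
    {y : w.1.adicCompletion E} (hy : Valued.v y ≤ 1) (hσy : galAdicCompletionMap (L := E) c hw y = -y) :
    Valued.v y < 1 := by
  have h := valued_galAdicCompletionMap_sub_lt_one_of_ramified E c v hc w hw he y hy
  rw [hσy, show -y - y = -(2 * y) by ring, Valuation.map_neg, map_mul, h2, one_mul] at h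
  exact h

/-! ## §2 Anti-fixed elements have odd valuation -/

/-- **`ι_w(π_v)` is a `σ_w`-FIXED element of valuation `exp(−2)`** at a ramified non-split place (`π_v` the tree's uniformiser of `F_v`,
`v_w ∘ ι_w = v_v^{e(w|v)}` ★ `valued_toPlace`, `e(w|v) = 2` ★ `ramificationIdx'_eq_two_of_ne_one`). [cite: SerreLocalFields1979, Ch. III §6] -/
theorem valued_toPlace_uniformizer_of_ramified (hc : c ≠ 1) (w : PlacesOver E v) (hw : c • w.1 = w.1)
    (he : v.asIdeal.ramificationIdx' w.1.asIdeal ≠ 1) :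
    Valued.v (toPlace v w (HeckeCharacter.uniformizer F v : v.adicCompletion F)) = WithZero.exp (-2 : ℤ) ∧
      galAdicCompletionMap (L := E) c hw (toPlace v w (HeckeCharacter.uniformizer F v : v.adicCompletion F)) =
        toPlace v w (HeckeCharacter.uniformizer F v : v.adicCompletion F) := by
  refine ⟨?_, galAdicCompletionMap_toPlace c w w hw _⟩
  rw [valued_toPlace, ramificationIdx'_eq_two_of_ne_one E v c hc w hw he, HeckeCharacter.valued_uniformizer, ← WithZero.exp_nsmul]
  norm_num

/-- **ANTI-FIXED ELEMENTS HAVE ODD VALUATION at a tamely ramified non-split place**: `σ_w y = −y`, `y ≠ 0` ⇒ `v_w(y) = exp(m)` with `m` odd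
(if `m = 2k`, `y · ι_w(π_v)^{k}` would be an anti-fixed unit, against §1). [cite: Jacobowitz1962, §5] [cite: SerreLocalFields1979, Ch. IV §2] -/
theorem odd_log_valued_of_galAdicCompletionMap_eq_neg (hc : c ≠ 1) (w : PlacesOver E v) (hw : c • w.1 = w.1)
    (he : v.asIdeal.ramificationIdx' w.1.asIdeal ≠ 1) (h2 : Valued.v (2 : w.1.adicCompletion E) = 1)
    {y : w.1.adicCompletion E} (hy0 : y ≠ 0) (hσy : galAdicCompletionMap (L := E) c hw y = -y) :
    Odd (WithZero.log (Valued.v y)) := by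
  set P : w.1.adicCompletion E := toPlace v w (HeckeCharacter.uniformizer F v : v.adicCompletion F) with hPdef
  obtain ⟨hvP, hσP⟩ := valued_toPlace_uniformizer_of_ramified E c hc w hw he
  rw [← hPdef] at hvP hσP
  have hP0 : P ≠ 0 := by
    intro h; rw [h, map_zero] at hvP; exact WithZero.zero_ne_coe hvP
  have hvy0 : Valued.v y ≠ 0 := (Valuation.ne_zero_iff _).2 hy0
  rcases Int.even_or_odd (WithZero.log (Valued.v y)) with ⟨k, hk⟩ | hodd
  · exfalso
    -- `u := y * P ^ k` is an anti-fixed unit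
    have hvu : Valued.v (y * P ^ k) = 1 := by
      rw [map_mul, map_zpow₀, hvP, ← WithZero.exp_log hvy0, hk, ← WithZero.exp_zsmul, ← WithZero.exp_add, ← WithZero.exp_zero]
      congr 1; simp only [smul_eq_mul]; ring
    have hσu : galAdicCompletionMap (L := E) c hw (y * P ^ k) = -(y * P ^ k) := by
      rw [map_mul, map_zpow₀, hσy, hσP, neg_mul]
    have hlt := valued_lt_one_of_galAdicCompletionMap_eq_neg E c hc w hw he h2 hvu.le hσu
    rw [hvu] at hlt
    exact lt_irrefl _ hlt
  · exact hodd

/-! ## §3 Existence of an anti-fixed uniformiser -/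

/-- **AN ANTI-FIXED UNIFORMISER EXISTS at a tamely ramified non-split place**: there is `ϖ ∈ E_wˣ` with `v_w(ϖ) = exp(−1)` and `σ_w ϖ = −ϖ`
(`ϖ := (x − σ_w x) · ι_w(π_v)^{k+1}` where `v_w(x − σ_w x) = exp(2k+1)` by §2; `σ_w ≠ id` ★ `exists_galAdicCompletionMap_ne`, `σ_w² = id` ★
`algEquiv_mul_self_eq_one`).  This is the binder `hσϖ : σ ϖ = −ϖ` of ★ `RamifiedQuadraticOrderUnitIndex` ∕ `…Lattices` ∕ `…LatticeDoubleCosets` at a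
concrete place. [cite: SerreLocalFields1979, Ch. IV §2 Prop. 5 and Ch. III §6] [cite: Jacobowitz1962, §5, §8] -/
theorem exists_uniformizer_galAdicCompletionMap_eq_neg_of_ramified (hc : c ≠ 1) (w : PlacesOver E v) (hw : c • w.1 = w.1)
    (he : v.asIdeal.ramificationIdx' w.1.asIdeal ≠ 1) (h2 : Valued.v (2 : w.1.adicCompletion E) = 1) :
    ∃ ϖ : (w.1.adicCompletion E)ˣ, Valued.v (ϖ : w.1.adicCompletion E) = WithZero.exp (-1 : ℤ) ∧
      galAdicCompletionMap (L := E) c hw ϖ = -ϖ := by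
  haveI : Algebra.IsSeparable F E := inferInstance
  set P : w.1.adicCompletion E := toPlace v w (HeckeCharacter.uniformizer F v : v.adicCompletion F) with hPdef
  obtain ⟨hvP, hσP⟩ := valued_toPlace_uniformizer_of_ramified E c hc w hw he
  rw [← hPdef] at hvP hσP
  -- an anti-fixed non-zero element
  obtain ⟨x, hx⟩ := exists_galAdicCompletionMap_ne F E c hc hw
  set D : w.1.adicCompletion E := x - galAdicCompletionMap (L := E) c hw x with hDdef
  have hD0 : D ≠ 0 := sub_ne_zero.2 (Ne.symm hx)
  have hσD : galAdicCompletionMap (L := E) c hw D = -D := by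
    rw [hDdef, map_sub, galAdicCompletionMap_galAdicCompletionMap_self F E c (algEquiv_mul_self_eq_one F hc) hw, neg_sub]
  obtain ⟨k, hk⟩ := odd_log_valued_of_galAdicCompletionMap_eq_neg E c hc w hw he h2 hD0 hσD
  have hvD0 : Valued.v D ≠ 0 := (Valuation.ne_zero_iff _).2 hD0
  have hϖ0 : D * P ^ (k + 1) ≠ 0 := by
    refine mul_ne_zero hD0 (zpow_ne_zero _ ?_)
    intro h; rw [h, map_zero] at hvP; exact WithZero.zero_ne_coe hvP
  refine ⟨Units.mk0 _ hϖ0, ?_, ?_⟩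
  · rw [Units.val_mk0, map_mul, map_zpow₀, hvP, ← WithZero.exp_log hvD0, hk, ← WithZero.exp_zsmul, ← WithZero.exp_add]
    congr 1; simp only [smul_eq_mul]; ring
  · rw [Units.val_mk0, map_mul, map_zpow₀, hσD, hσP, neg_mul]

/-! ## §4 The CM row -/

/-- **THE CM ROW**: for a CM field `L` (`F = L⁺`, `c` = complex conjugation) and a place `w ∣ v` of `L` fixed by `c`, RAMIFIED over `L⁺` and
prime to `2`, there is a uniformiser `ϖ_w ∈ L_wˣ` with `c_w ϖ_w = −ϖ_w`. [cite: Jacobowitz1962, §5, §8] [cite: SerreLocalFields1979, Ch. IV §2] -/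
theorem exists_uniformizer_galAdicCompletionMap_complexConj_eq_neg_of_ramified (L : Type) [Field L] [NumberField L] [IsCMField L]
    {v : HeightOneSpectrum (𝓞 ↥(maximalRealSubfield L))} (w : PlacesOver L v) (hw : IsCMField.complexConj L • w.1 = w.1)
    (he : v.asIdeal.ramificationIdx' w.1.asIdeal ≠ 1) (h2 : Valued.v (2 : w.1.adicCompletion L) = 1) :
    ∃ ϖ : (w.1.adicCompletion L)ˣ, Valued.v (ϖ : w.1.adicCompletion L) = WithZero.exp (-1 : ℤ) ∧
      galAdicCompletionMap (L := L) (IsCMField.complexConj L) hw ϖ = -ϖ :=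
  exists_uniformizer_galAdicCompletionMap_eq_neg_of_ramified L (IsCMField.complexConj L) (IsCMField.complexConj_ne_one L) w hw he h2

end Literature.NumberTheory.Automorphic.UnitaryGroup
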